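import Summits.BirchSwinnertonDyer.BirchSwinnertonDyer.Theorems.AlignedTransportAtTwoMainConjectureTransportAlignedAtTwoOrdPlusLineOdd
import Summits.BirchSwinnertonDyer.BirchSwinnertonDyer.Theorems.AlignedTransportAtTwoMainConjectureTransportAlignedAtTwoKilfordKernelLetterCrossLevelCarrier
import Summits.BirchSwinnertonDyer.BirchSwinnertonDyer.Theorems.AlignedTransportAtTwoMainConjectureTransportAlignedAtTwoKilfordCopyCrossLevelFactor
import Summits.BirchSwinnertonDyer.BirchSwinnertonDyer.Theorems.AlignedTransportAtTwoMainConjectureTransportAlignedAtTwoKilfordCopyNegDiscFunctional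
import HarnessLib

/-!
# Crux C1 `MainConjectureTransportAlignedAtTwo` (stmt-BirchSwinnertonDyer-22296), line `birth`, residual (R2) `stub_lamLawKilford`, UNEQUAL
# conductors: ROW (r5) FOR GENERALISED OLD FORMS FROM `μ = 0` ALONE — II. the homology half: (K2) for lattice-compatible values, the factor
# operator as a fold, integrality, and «two cusps with non-integral table difference ⟹ a half-class not killed» (width seat att-p4 g19; `--supports 22296`)

THEOREMS ONLY (no `def`, no `sorry`, no named fact, no instance). BSD is not proved by this; C1 is not closed by this.

For a parametrisation datum `D` of `W` at the conductor level with ODD Manin constant, the plus period unit `Ω(W) = u·Ω⁺_f` (`‖u‖₂ = 1`), and att-p3 g19's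
generalised old form `F ∈ S₂(Γ₀(L))` (`L` odd), `{∞, s}_F = ((∏_{ℓ∈S}([1] + ρ_ℓ[ℓ] + σ_ℓ[ℓ²]))·{∞,·}_f)(s)` (data as in
`…KilfordCopyCrossLevelFactorForms.exists_factorForm_coeff`), lattice-compatible (`hg`):
**`exists_jacobiMapForm_half_ne_zero_of_foldTable_sub`** — IF two `2`-power cusps `r₁, r₂` have folded-table values `Ψ(r₁), Ψ(r₂)`,
`Ψ = (∏R_ℓ)·[·]⁺_f` (the pointwise fold of the sibling `…CrossLevelFactorMu`, over the list `S.toList`), differing by a NON-`2`-integral rational, THEN some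
cycle `y ∈ H₁(X₀(L);ℤ)` has `D.jacobiMapForm L F _ [y/2] ≠ O`: `rᵢ = γᵢ·0`, `y = {∞,γ₁∞} − {∞,γ₂∞}`, `y(F) = {∞,r₁}_F − {∞,r₂}_F`, `re y(F) = Ω⁺_f(Ψ(r₁) − Ψ(r₂))`,
`n = 2re y(F)/Ω⁺_f ∈ ℤ` is ODD, and (K2) applies. The hypothesis is discharged from `μ = 0` in the sibling III `…CrossLevelFactorMuCertificate`.

* §1 `even_of_half_mem_of_mul_mem` (`Δ > 0`), `…_of_Δ_neg`, `uniformize_half_ne_zero_of_odd` — (K2)/(K2⁻) of `…DeltaPosFunctional` /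
  `…KilfordCopyNegDiscFunctional` for ANY `w ∈ ℂ` with `c·w ∈ Λ_E` in place of `x(f)`.
* §2 `act_prod_eq_fold`, `re_fold_modularSymbol_eq` — the operator IS the fold; its real part is `Ω⁺_f` times the folded rational table.
* §3 `exists_int_two_mul_re_div_plusPeriod` — `2re y(F)/Ω⁺_f ∈ ℤ` on `H₁(X₀(L);ℤ)` (`y(F) ∈ Λ_f` by `factorForm_mul_apply_mem`, `re Λ_f = ℤ·Ω⁺_f/2`).
* §4 the theorem.

References: Mazur–Tate–Teitelbaum 1986 §I.8, §I.10 [MazurTateTeitelbaum1986Invent]; Cremona 1997 §2.4, §2.8, §2.10 [CremonaAlgorithms1997]; Manin 1972 Prop. 1.4,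
Thm. 1.6 [Manin1972]; Lawden 1989 §6.15–§6.17 [Lawden1989]; Abbes–Ullmo 1996 Thm. A [AbbesUllmo1996].
-/

noncomputable section

-- justification: the `Summit.BirchSwinnertonDyer.BirchSwinnertonDyer.…` path repeats a component (route-file convention)
set_option linter.dupNamespace false
set_option autoImplicit false

open scoped MatrixGroups ModularForm NumberField Classical
open CongruenceSubgroup Complex WeierstrassCurve IsDedekindDomain
open Literature.NumberTheory.EllipticCurves Literature.NumberTheory.EllipticCurves.ModularForms
open Literature.NumberTheory.EllipticCurves.Greenberg1999 Literature.NumberTheory.EllipticCurves.GreenbergVatsal2000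
open Summit.BirchSwinnertonDyer.Rank1Residual.F1Sign2 Summit.BirchSwinnertonDyer.Rank1Residual.X1.MuLambda
open Summit.BirchSwinnertonDyer.BirchSwinnertonDyer.Theorems.ThetaLayerLambdaCongruenceAtTwo
open Summit.BirchSwinnertonDyer.BirchSwinnertonDyer.Theorems.AlignedTransportAtTwoDepletedPeriodFormula
open Summit.BirchSwinnertonDyer.BirchSwinnertonDyer.Theorems.AlignedTransportAtTwoOrdPlusLineTools
open Summit.BirchSwinnertonDyer.BirchSwinnertonDyer.Theorems.AlignedTransportAtTwoOrdPlusLineOdd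
open Summit.BirchSwinnertonDyer.BirchSwinnertonDyer.Theorems.AlignedTransportAtTwoDeltaPosFunctional
open Summit.BirchSwinnertonDyer.BirchSwinnertonDyer.Theorems.AlignedTransportAtTwoKilfordCopyNegDiscFunctional
open Summit.BirchSwinnertonDyer.BirchSwinnertonDyer.Theorems.AlignedTransportAtTwoKilfordCopyCrossLevelTools
open Summit.BirchSwinnertonDyer.BirchSwinnertonDyer.Theorems.AlignedTransportAtTwoKilfordCopyCrossLevelFactor
open Summit.BirchSwinnertonDyer.BirchSwinnertonDyer.Theorems.AlignedTransportAtTwoKilfordKernelLetterCrossLevelCarrier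

namespace Summit.BirchSwinnertonDyer.BirchSwinnertonDyer.Theorems.AlignedTransportAtTwoKilfordKernelLetterCrossLevelFactorPlusValue

/-! ## §1 (K2) for lattice-compatible values: an odd plus value is not killed by `u_W(c·–/2)` -/

section K2

variable {W : WeierstrassCurve ℚ} [W.IsElliptic] {N : ℕ} [NeZero N] (D : ModularParametrizationData W N)

/-- **(K2) for a lattice-compatible value, `Δ(W) > 0`.** `D` a datum of `W` with ODD Manin constant `c`, `Ω(W) = u·Ω⁺_f` (`‖u‖₂ = 1`), `w ∈ ℂ` with
`c·w ∈ Λ_E` and INTEGER plus value `n`, `n·Ω⁺_f = 2·re w`: if `c·w/2 ∈ Λ_E` then `n` is even (`c·w = aΩ₀ + k·iΩ₀'`, `a·u = c·n`).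
The case `w = x(f)` is `…DeltaPosFunctional.even_plusValue_iff_half_mem_or_sub_halfPeriodI_mem`. [cite: CremonaAlgorithms1997, §2.8 (p. 26), §2.10] -/
theorem even_of_half_mem_of_mul_mem (hΔ : 0 < W.Δ) (hc : Odd D.c) {u : ℚ} (hu : ‖(u : ℚ_[2])‖ = 1)
    (hΩ : W.realPeriodRat = u * plusPeriod D.f) {w : ℂ} (hw : (D.c : ℂ) * w ∈ D.L.lattice)
    {n : ℤ} (hn : (n : ℝ) * plusPeriod D.f = 2 * w.re) (hmem : (D.c : ℂ) * w / 2 ∈ D.L.lattice) : Even n := by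
  have hreal := D.isReal_neronLattice
  have hdisc := discr_pos_of_Δ_pos D hΔ
  have hΩpos : 0 < D.L.minRealPeriod := hreal.minRealPeriod_pos
  obtain ⟨a, k, hak⟩ := exists_eq_int_mul_add_int_mul_of_discr_pos hreal hdisc hw
  have ha : Even a := by
    rw [← half_mem_or_sub_halfPeriodI_mem_iff_even hreal hdisc (a := a) (k := k), ← hak]
    exact Or.inl hmem
  -- `Even n ↔ Even a`, from `a·u = c·n`
  have hre : ((D.c : ℂ) * w).re = a * D.L.minRealPeriod := by rw [hak]; simp
  have hre' : ((D.c : ℂ) * w).re = D.c * w.re := by simp [Complex.mul_re]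
  have hu0 : u ≠ 0 := by rintro rfl; simp at hu
  have h2 : W.realPeriodRat = 2 * D.L.minRealPeriod := realPeriodRat_eq_two_mul_of_Δ_pos D hΔ
  have hplus' : plusPeriod D.f * u = 2 * D.L.minRealPeriod := by
    have hu0' : (u : ℝ) ≠ 0 := by exact_mod_cast hu0
    rw [← h2, hΩ]; field_simp
  have key : (a : ℝ) * u = D.c * n := by
    have h1 : (a : ℝ) * D.L.minRealPeriod = D.c * w.re := by rw [← hre, hre']
    have h3 : 2 * (w.re * u) = 2 * (n * D.L.minRealPeriod) := by
      calc 2 * (w.re * u) = (n * plusPeriod D.f) * u := by rw [hn]; ring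
        _ = n * (plusPeriod D.f * u) := by ring
        _ = 2 * (n * D.L.minRealPeriod) := by rw [hplus']; ring
    have h3' : w.re * u = n * D.L.minRealPeriod := by linarith
    have h4 : D.L.minRealPeriod * ((a : ℝ) * u - D.c * n) = 0 := by
      linear_combination (u : ℝ) * h1 + (D.c : ℝ) * h3'
    rcases mul_eq_zero.mp h4 with h0 | h0
    · exact absurd h0 hΩpos.ne'
    · linarith
  have key' : (a : ℚ) * u = D.c * n := by exact_mod_cast key
  exact (even_iff_even_of_mul_unit_eq_odd_mul hu hc key').mp ha

/-- **(K2⁻) for a lattice-compatible value, `Δ(W) < 0`** (rhombic Néron lattice; twin of `even_of_half_mem_of_mul_mem`).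
[cite: CremonaAlgorithms1997, §2.8 (p. 26), §2.10] -/
theorem even_of_half_mem_of_mul_mem_of_Δ_neg (hΔ : W.Δ < 0) (hc : Odd D.c) {u : ℚ} (hu : ‖(u : ℚ_[2])‖ = 1)
    (hΩ : W.realPeriodRat = u * plusPeriod D.f) {w : ℂ} (hw : (D.c : ℂ) * w ∈ D.L.lattice)
    {n : ℤ} (hn : (n : ℝ) * plusPeriod D.f = 2 * w.re) (hmem : (D.c : ℂ) * w / 2 ∈ D.L.lattice) : Even n := by
  have hreal := D.isReal_neronLattice
  have hΩpos : 0 < D.L.minRealPeriod := hreal.minRealPeriod_pos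
  obtain ⟨a, ha⟩ := hreal.exists_re_eq_int_mul_half hw
  have ha' : 2 * ((D.c : ℂ) * w).re = a * D.L.minRealPeriod := by rw [ha]; ring
  have haev : Even a := by
    rw [← half_mem_or_sub_halfPeriodI_mem_iff_even_of_rhombic hreal (halfPeriodI_add_half_mem_of_Δ_neg D hΔ) hw ha']
    exact Or.inl hmem
  have hre' : ((D.c : ℂ) * w).re = D.c * w.re := by simp [Complex.mul_re]
  have hu0 : u ≠ 0 := by rintro rfl; simp at hu
  have h1 : W.realPeriodRat = D.L.minRealPeriod := realPeriodRat_eq_of_Δ_neg D hΔ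
  have hplus' : plusPeriod D.f * u = D.L.minRealPeriod := by
    have hu0' : (u : ℝ) ≠ 0 := by exact_mod_cast hu0
    rw [← h1, hΩ]; field_simp
  have key : (a : ℝ) * u = D.c * n := by
    have h2 : (a : ℝ) * D.L.minRealPeriod = D.c * (n * plusPeriod D.f) := by rw [hn, ← ha', hre']; ring
    have h3 : D.L.minRealPeriod * ((a : ℝ) * u - D.c * n) = 0 := by
      linear_combination (u : ℝ) * h2 + (D.c : ℝ) * (n : ℝ) * hplus'
    rcases mul_eq_zero.mp h3 with h0 | h0
    · exact absurd h0 hΩpos.ne'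
    · linarith
  have key' : (a : ℚ) * u = D.c * n := by exact_mod_cast key
  exact (even_iff_even_of_mul_unit_eq_odd_mul hu hc key').mp haev

/-- **An ODD plus value is not killed: `u_W(c·w/2) ≠ O`** (either sign of `Δ`; `ker u_W = Λ_E`). [cite: CremonaAlgorithms1997, §2.8, §2.10] -/
theorem uniformize_half_ne_zero_of_odd (hc : Odd D.c) {u : ℚ} (hu : ‖(u : ℚ_[2])‖ = 1)
    (hΩ : W.realPeriodRat = u * plusPeriod D.f) {w : ℂ} (hw : (D.c : ℂ) * w ∈ D.L.lattice)
    {n : ℤ} (hn : (n : ℝ) * plusPeriod D.f = 2 * w.re) (hodd : Odd n) : D.uniformize ((D.c : ℂ) * w / 2) ≠ 0 := by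
  intro h0
  have hmem : (D.c : ℂ) * w / 2 ∈ D.L.lattice := by
    rw [← SetLike.mem_coe, ← D.ker_uniformize, SetLike.mem_coe, AddMonoidHom.mem_ker]
    exact h0
  rcases lt_or_gt_of_ne W.isUnit_Δ.ne_zero with hΔ | hΔ
  · exact (Int.not_even_iff_odd.mpr hodd) (even_of_half_mem_of_mul_mem_of_Δ_neg D hΔ hc hu hΩ hw hn hmem)
  · exact (Int.not_even_iff_odd.mpr hodd) (even_of_half_mem_of_mul_mem D hΔ hc hu hΩ hw hn hmem)

end K2

/-! ## §2 att-p3's operator `∏(single 1 1 + single ℓ ρ + single ℓ² σ)` on `{∞,·}_f` is the fold, and its real part is `Ω⁺_f` times the folded table -/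

section Bridge

/-- **The product operator acts as the fold**: for a list `l` of data `(ℓ, ρ, σ)` and any `ψ : ℚ → ℂ`,
`((∏_{t∈l}([1] + ρ_t[ℓ_t] + σ_t[ℓ_t²]))·ψ)(x)` is the pointwise fold `ψ ↦ ψ + ρ_tψ(ℓ_t·) + σ_tψ(ℓ_t²·)` (`…Tools.act_factor_mul`). [folklore] -/
theorem act_prod_eq_fold (ψ : ℚ → ℂ) (l : List (ℕ × ℤ × ℤ)) :
    ∀ x : ℚ, (((l.map fun (t : ℕ × ℤ × ℤ) ↦ (MonoidAlgebra.single 1 (1 : ℂ) + MonoidAlgebra.single t.1 ((t.2.1 : ℤ) : ℂ) +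
        MonoidAlgebra.single (t.1 ^ 2) ((t.2.2 : ℤ) : ℂ) : MonoidAlgebra ℂ ℕ)).prod).coeff.sum fun m a ↦ a * ψ ((m : ℚ) * x)) =
      (List.foldr (fun (t : ℕ × ℤ × ℤ) (χ : ℚ → ℂ) (x : ℚ) ↦
        χ x + ((t.2.1 : ℤ) : ℂ) * χ ((t.1 : ℚ) * x) + ((t.2.2 : ℤ) : ℂ) * χ (((t.1 ^ 2 : ℕ) : ℚ) * x)) ψ l) x := by
  induction l with
  | nil =>
    intro x
    rw [List.map_nil, List.prod_nil, List.foldr_nil, MonoidAlgebra.one_def, act_single, Nat.cast_one, one_mul, one_mul]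
  | cons t l ih =>
    intro x
    simp only [List.map_cons, List.prod_cons, List.foldr_cons]
    rw [act_factor_mul, ih, ih, ih]

variable {W : WeierstrassCurve ℚ} [W.IsElliptic] [W.IsGloballyMinimal] [NeZero (W.conductorNorm ℤ)] {f : CuspForm (Gamma0 (W.conductorNorm ℤ)) 2}

omit [W.IsElliptic] [W.IsGloballyMinimal] in
/-- **`re ((∏R_ℓ)·{∞,·}_f)(x) = Ω⁺_f · ((∏R_ℓ)·[·]⁺_f)(x)`** for the newform `f` of `W` (integer data; `re{∞,y}_f = Ω⁺_f·[y]⁺_f`).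
[cite: MazurTateTeitelbaum1986Invent, §I.8] -/
theorem re_fold_modularSymbol_eq (hf : IsNewformOf W f) (l : List (ℕ × ℤ × ℤ)) :
    ∀ x : ℚ, ((List.foldr (fun (t : ℕ × ℤ × ℤ) (χ : ℚ → ℂ) (x : ℚ) ↦
        χ x + ((t.2.1 : ℤ) : ℂ) * χ ((t.1 : ℚ) * x) + ((t.2.2 : ℤ) : ℂ) * χ (((t.1 ^ 2 : ℕ) : ℚ) * x)) (modularSymbol f) l) x).re =
      plusPeriod f * ((List.foldr (fun (t : ℕ × ℤ × ℤ) (ψ : ℚ → ℚ) (x : ℚ) ↦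
        ψ x + (t.2.1 : ℚ) * ψ ((t.1 : ℚ) * x) + (t.2.2 : ℚ) * ψ (((t.1 ^ 2 : ℕ) : ℚ) * x)) (ratPlusSymbol f) l x : ℚ) : ℝ) := by
  induction l with
  | nil =>
    intro x
    simp only [List.foldr_nil]
    have h := re_modularSymbol_eq_plusPeriod_mul hf x
    exact_mod_cast h
  | cons t l ih =>
    intro x
    simp only [List.foldr_cons, Complex.add_re, Complex.mul_re, Complex.intCast_re, Complex.intCast_im, zero_mul, sub_zero, ih]
    push_cast
    ring

end Bridge

/-! ## §3 `2·re y(F)/Ω⁺_f ∈ ℤ` on `H₁(X₀(L);ℤ)` for the generalised old form -/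

section Integrality

variable {N L : ℕ} [NeZero N] [NeZero L] {W : WeierstrassCurve ℚ} [W.IsElliptic] [W.IsGloballyMinimal]

omit [W.IsElliptic] [W.IsGloballyMinimal] in
/-- **Integrality of the plus functional of `F` on cycles**: for the newform `f` of `W` and ANY `F ∈ S₂(Γ₀(L))` with `{∞,s}_F = ((∏R_ℓ)·{∞,·}_f)(s)`
(`N·∏ℓ^{e_ℓ} ∣ L`), every `y ∈ H₁(X₀(L);ℤ)` has `2·re y(F)/Ω⁺_f ∈ ℤ`: `y(F) ∈ Λ_f` (`factorForm_mul_apply_mem` with `Λ = Λ_f`, `c = 1`) and `re Λ_f = ℤ·Ω⁺_f/2`.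
[cite: CremonaAlgorithms1997, §2.4, §2.8] -/
theorem exists_int_two_mul_re_div_plusPeriod {f : CuspForm (Gamma0 N) 2} (hf : IsNewformOf W f)
    (ρ σ : ℕ → ℤ) (e : ℕ → ℕ) (S : Finset ℕ) (hS0 : ∀ ℓ ∈ S, ℓ ≠ 0)
    (hρ : ∀ ℓ ∈ S, e ℓ = 0 → ρ ℓ = 0) (hσ : ∀ ℓ ∈ S, e ℓ ≤ 1 → σ ℓ = 0) (hNL : N * ∏ ℓ ∈ S, ℓ ^ e ℓ ∣ L)
    (F : CuspForm (Gamma0 L) 2)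
    (hF : ∀ s : ℚ, modularSymbol F s =
      ((∏ ℓ ∈ S, (MonoidAlgebra.single 1 (1 : ℂ) + MonoidAlgebra.single ℓ ((ρ ℓ : ℤ) : ℂ) +
        MonoidAlgebra.single (ℓ ^ 2) ((σ ℓ : ℤ) : ℂ)) : MonoidAlgebra ℂ ℕ).coeff.sum fun m a ↦ a * modularSymbol f ((m : ℚ) * s))) :
    ∀ y ∈ periodHomology L, ∃ z : ℤ, (2 / plusPeriod f) * (y F).re = z := by
  have hΩ : 0 < plusPeriod f := IsNewform0.plusPeriod_pos_holds hf.1 hf.coeffField_eq_bot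
  have hre := (realPeriods_eq_zmultiples_of_plusPeriod_ne_zero f hΩ.ne').1
  have hmemΛ := factorForm_mul_apply_mem f ρ σ e S hS0 hρ hσ hNL F hF (periodLattice f) 1 (fun z hz ↦ by rwa [one_mul])
  intro y hy
  have hmem : y F ∈ periodLattice f := by have h := hmemΛ y hy; rwa [one_mul] at h
  have hreal : (y F).re ∈ realPeriods f := AddSubgroup.mem_map_of_mem _ hmem
  rw [hre, AddSubgroup.mem_zmultiples_iff] at hreal
  obtain ⟨k, hk⟩ := hreal
  refine ⟨k, ?_⟩
  rw [zsmul_eq_mul] at hk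
  rw [div_mul_eq_mul_div, div_eq_iff hΩ.ne']
  linear_combination (-2 : ℝ) * hk

end Integrality

/-! ## §4 Two cusps with non-integral table difference ⟹ a half-class not killed by `D.jacobiMapForm L F` -/

section Main

/-- **Two `2`-power cusps with non-integral folded-table difference give the row (r5).** `D` a datum of `W` at the conductor level with ODD Manin constant,
`Ω(W) = u·Ω⁺_f` with `‖u‖₂ = 1`; `S` a set of non-zero naturals with integer data `(ρ_ℓ, σ_ℓ, e_ℓ)` (`ρ_ℓ = 0` unless `e_ℓ ≥ 1`, `σ_ℓ = 0` unless `e_ℓ ≥ 2`), an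
ODD level `L` with `N_W·∏ℓ^{e_ℓ} ∣ L`, and ANY `F ∈ S₂(Γ₀(L))` with `{∞, s}_F = ((∏_{ℓ∈S}([1] + ρ_ℓ[ℓ] + σ_ℓ[ℓ²]))·{∞,·}_{D.f})(s)`, lattice-compatible (`hg`).
IF the folded table `Ψ = (∏R_ℓ)·[·]⁺_{D.f}` (fold over `S.toList`) takes values at two `2`-power cusps differing by a non-`2`-integral rational, THEN some
`y ∈ H₁(X₀(L);ℤ)` has `D.jacobiMapForm L F hg [y/2] ≠ O`. [cite: MazurTateTeitelbaum1986Invent, §I.10 (10.1)] [cite: CremonaAlgorithms1997, §2.4, §2.8, §2.10]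
[cite: Manin1972, Prop. 1.4 and Thm. 1.6] -/
theorem exists_jacobiMapForm_half_ne_zero_of_foldTable_sub
    (W : WeierstrassCurve ℚ) [W.IsElliptic] [W.IsGloballyMinimal] [NeZero (W.conductorNorm ℤ)]
    (D : ModularParametrizationData W (W.conductorNorm ℤ)) (hc : Odd D.c) {u : ℚ} (hu : ‖(u : ℚ_[2])‖ = 1)
    (hΩ : W.realPeriodRat = u * plusPeriod D.f)
    (ρ σ : ℕ → ℤ) (e : ℕ → ℕ) (S : Finset ℕ) (hS0 : ∀ ℓ ∈ S, ℓ ≠ 0)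
    (hρ : ∀ ℓ ∈ S, e ℓ = 0 → ρ ℓ = 0) (hσ : ∀ ℓ ∈ S, e ℓ ≤ 1 → σ ℓ = 0)
    (L : ℕ) [NeZero L] (hL : Odd L) (hNL : W.conductorNorm ℤ * ∏ ℓ ∈ S, ℓ ^ e ℓ ∣ L)
    (F : CuspForm (Gamma0 L) 2)
    (hF : ∀ s : ℚ, modularSymbol F s =
      ((∏ ℓ ∈ S, (MonoidAlgebra.single 1 (1 : ℂ) + MonoidAlgebra.single ℓ ((ρ ℓ : ℤ) : ℂ) +
        MonoidAlgebra.single (ℓ ^ 2) ((σ ℓ : ℤ) : ℂ)) : MonoidAlgebra ℂ ℕ).coeff.sum fun m a ↦ a * modularSymbol D.f ((m : ℚ) * s)))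
    (hg : ∀ φ ∈ periodHomology L, (D.c : ℂ) * φ F ∈ D.L.lattice)
    (hcert : ∃ m₁ k₁ m₂ k₂ : ℕ, 1 < ‖(((List.foldr (fun (t : ℕ × ℤ × ℤ) (ψ : ℚ → ℚ) (x : ℚ) ↦
        ψ x + (t.2.1 : ℚ) * ψ ((t.1 : ℚ) * x) + (t.2.2 : ℚ) * ψ (((t.1 ^ 2 : ℕ) : ℚ) * x)) (ratPlusSymbol D.f) (S.toList.map (fun ℓ ↦ (ℓ, ρ ℓ, σ ℓ)))) ((m₁ : ℚ) / (2 : ℚ) ^ k₁) - (List.foldr (fun (t : ℕ × ℤ × ℤ) (ψ : ℚ → ℚ) (x : ℚ) ↦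
        ψ x + (t.2.1 : ℚ) * ψ ((t.1 : ℚ) * x) + (t.2.2 : ℚ) * ψ (((t.1 ^ 2 : ℕ) : ℚ) * x)) (ratPlusSymbol D.f) (S.toList.map (fun ℓ ↦ (ℓ, ρ ℓ, σ ℓ)))) ((m₂ : ℚ) / (2 : ℚ) ^ k₂) : ℚ) : ℚ_[2])‖) :
    ∃ y ∈ periodHomology L, D.jacobiMapForm L F hg (Submodule.Quotient.mk ((2 : ℂ)⁻¹ • y)) ≠ 0 := by
  have hΩpos : 0 < plusPeriod D.f := IsNewform0.plusPeriod_pos_holds D.isNewformOf.1 D.isNewformOf.coeffField_eq_bot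
  obtain ⟨m₁, k₁, m₂, k₂, hbig⟩ := hcert
  set l : List (ℕ × ℤ × ℤ) := S.toList.map (fun ℓ ↦ (ℓ, ρ ℓ, σ ℓ)) with hl
  set Ψ : ℚ → ℚ := List.foldr (fun (t : ℕ × ℤ × ℤ) (ψ : ℚ → ℚ) (x : ℚ) ↦
        ψ x + (t.2.1 : ℚ) * ψ ((t.1 : ℚ) * x) + (t.2.2 : ℚ) * ψ (((t.1 ^ 2 : ℕ) : ℚ) * x)) (ratPlusSymbol D.f) l with hΨ
  have hΩne : plusPeriod D.f ≠ 0 := hΩpos.ne'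
  -- the product operator is the fold: `re {∞, r}_F = Ω⁺_f·Ψ(r)`
  have hprod : (∏ ℓ ∈ S, (MonoidAlgebra.single 1 (1 : ℂ) + MonoidAlgebra.single ℓ ((ρ ℓ : ℤ) : ℂ) +
      MonoidAlgebra.single (ℓ ^ 2) ((σ ℓ : ℤ) : ℂ)) : MonoidAlgebra ℂ ℕ) =
      (l.map fun (t : ℕ × ℤ × ℤ) ↦ (MonoidAlgebra.single 1 (1 : ℂ) + MonoidAlgebra.single t.1 ((t.2.1 : ℤ) : ℂ) +
        MonoidAlgebra.single (t.1 ^ 2) ((t.2.2 : ℤ) : ℂ) : MonoidAlgebra ℂ ℕ)).prod := by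
    rw [hl, List.map_map, ← Finset.prod_map_toList]
    rfl
  have hreF : ∀ r : ℚ, (modularSymbol F r).re = plusPeriod D.f * ((Ψ r : ℚ) : ℝ) := by
    intro r
    rw [hF r, hprod, act_prod_eq_fold, re_fold_modularSymbol_eq D.isNewformOf l r]
  -- the cycle `y = {∞,γ₁∞} − {∞,γ₂∞}` with `y(F) = {∞,r₁}_F − {∞,r₂}_F`
  obtain ⟨γ₁, hγ₁⟩ := exists_gamma0_modularSymbol_eq_of_coprime_den (N' := L) (coprime_den_twoPow hL m₁ k₁)
  obtain ⟨γ₂, hγ₂⟩ := exists_gamma0_modularSymbol_eq_of_coprime_den (N' := L) (coprime_den_twoPow hL m₂ k₂)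
  set y : Module.Dual ℂ (CuspForm (Gamma0 L) 2) := periodFunctional L γ₁ - periodFunctional L γ₂ with hy
  have hymem : y ∈ periodHomology L :=
    (periodHomology L).sub_mem (periodFunctional_mem_periodHomology L γ₁) (periodFunctional_mem_periodHomology L γ₂)
  have hyF : y F = modularSymbol F ((m₁ : ℚ) / (2 : ℚ) ^ k₁) - modularSymbol F ((m₂ : ℚ) / (2 : ℚ) ^ k₂) := by
    rw [hy, LinearMap.sub_apply, periodFunctional_apply, periodFunctional_apply, hγ₁ F, hγ₂ F]
    ring
  -- the integer plus value of `y` is `2(Ψ(r₁) − Ψ(r₂))`, hence odd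
  obtain ⟨z, hz⟩ := exists_int_two_mul_re_div_plusPeriod (W := W) D.isNewformOf ρ σ e S hS0 hρ hσ hNL F hF y hymem
  have hzQ : (z : ℚ) = 2 * (Ψ ((m₁ : ℚ) / (2 : ℚ) ^ k₁) - Ψ ((m₂ : ℚ) / (2 : ℚ) ^ k₂)) := by
    have hzR : (z : ℝ) = 2 * (((Ψ ((m₁ : ℚ) / (2 : ℚ) ^ k₁) : ℚ) : ℝ) - ((Ψ ((m₂ : ℚ) / (2 : ℚ) ^ k₂) : ℚ) : ℝ)) := by
      rw [← hz, hyF, Complex.sub_re, hreF, hreF]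
      field_simp
    exact_mod_cast hzR
  have hzodd : Odd z := by
    apply odd_of_half_lt_norm
    have hcast : (z : ℚ_[2]) = ((z : ℚ) : ℚ_[2]) := by norm_cast
    have h2 : ‖(2 : ℚ_[2])‖ = 2⁻¹ := by
      have h := @Padic.norm_p 2 _
      push_cast at h
      exact h
    have hb : 1 < ‖(((Ψ ((m₁ : ℚ) / (2 : ℚ) ^ k₁) - Ψ ((m₂ : ℚ) / (2 : ℚ) ^ k₂) : ℚ)) : ℚ_[2])‖ := hbig
    rw [hcast, hzQ, Rat.cast_mul, norm_mul]
    have h2' : ‖((2 : ℚ) : ℚ_[2])‖ = 2⁻¹ := by push_cast; exact h2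
    rw [h2']
    linarith
  -- (K2): `u_W(c·y(F)/2) ≠ O`
  have hn : (z : ℝ) * plusPeriod D.f = 2 * (y F).re := by
    rw [← hz]
    field_simp
  refine ⟨y, hymem, fun h0 ↦ uniformize_half_ne_zero_of_odd D hc hu hΩ (hg y hymem) hn hzodd ?_⟩
  rwa [jacobiMapForm_half_eq] at h0

end Main

end Summit.BirchSwinnertonDyer.BirchSwinnertonDyer.Theorems.AlignedTransportAtTwoKilfordKernelLetterCrossLevelFactorPlusValue

end
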